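import Mathlib.RingTheory.Localization.Away.Basic
import Mathlib.RingTheory.Ideal.Quotient.Operations
import HarnessLib

/-!
# EL♮(3) / EL♮(n), RUNG LC «large characteristic» — brick (B5)/(B6) POINT BOOKKEEPING: a point `θ : R → k` with `𝔮 ⊆ ker θ ∌ f` factors through the
# shrunken base `B = (R/𝔮)[1/a][1/a₀]`

leafhand-res-equisingularlift-3 g0 (prover, 2026-08-31; one-generation line-first hand on stmt-ResolutionOfSingularities-20148 / -20038 /
-15660, cell `pub/decomp-res`).  Crux `EquisingularLiftNatThree` (`stmt-…-20148`; uniform in `n`, so also `stmt-…-20038`), line W4.5(b), RUNG LC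
(idea-2 g32 `Cruxes/EquisingularLiftNatThree/LARGE-CHAR-RUNG-idea2.md` v1.6 §(B5) «for `φ : CoeffRingP → k` with `ker φ ⊇ 𝔮` and `φ(a a₀) ≠ 0`, `θ :=` the
induced `B → k`», §(B6) «for `𝔮 ∌` every prime number: `∃ f := a a₀ b ∉ 𝔮` with Good on `V(𝔮) ∩ D(f)`»).  The binder shape of `hspread` in
✓ `LargeChar.elnatLargeChar_of_spread_of_engine` is «`∃ f ∉ 𝔮, ∀ 𝔭 ⊇ 𝔮 prime, f ∉ 𝔭 → ∀ θ, ker θ = 𝔭 → …`»; the door theorems of this hand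
(✓ `exists_forall_descDoorAt_of_K_word_smooth`, base ✓ `LargeChar.exists_smooth_away_away`) deliver the door over `B = A[1/a][1/a₀]`, `A = R ⧸ 𝔮`, at
points `θ_B : B → k`.  This file supplies the `f` and the factorisation, DEF-FREE and purely ring-theoretic:

* ★ `exists_witness_factor_through_away_away` — for a prime `𝔮` of `R`, `A := R ⧸ 𝔮`, `a ≠ 0` in `A` and `a₀ ≠ 0` in `A[1/a]`: there is `f : R` with
  `f ∉ 𝔮` such that every ring map `θ : R → k` to a field with `𝔮 ≤ ker θ` and `θ f ≠ 0` FACTORS through `R → A → A[1/a] → A[1/a][1/a₀]`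
  (write `a₀ · a^m = a₁` by Mathlib `IsLocalization.surj`, take `f` a lift of `a · a₁`; lift by Mathlib `Ideal.Quotient.lift` and `IsLocalization.Away.lift` twice).

USE: with `hspread`'s `𝔭 := ker θ` (so `𝔮 ≤ 𝔭` and `f ∉ 𝔭 ⇔ θ f ≠ 0`), the door at `θ_B` gives `DescDoorAt B k θ_B`, and the N:=1 glue (lh2) gives
`DescDoorSharp k n H ι` — independent of the factorisation.  HONEST RESIDUAL of `hspread` (unchanged otherwise): K-side inputs for the universal hypersurface
(reduced generic equation, geometric-integrality dichotomy, ✓ `LargeChar.exists_centreSeq_descTransformOK`), N:=1 glue, final composition.  EL♮(3) NOT proved;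
EL♮ NOT proved; resolution of singularities in positive characteristic NOT proved; nothing of [Hironaka2017] (a candidate under adjudication) is asserted or
used.  [OURS · ring-theory bookkeeping · standard axioms · DEF-FREE · `--supports stmt-ResolutionOfSingularities-20148 --as helper`, counted 0 · AI-written,
weaker than expert review.] [folklore]
-/

set_option linter.dupNamespace false -- mandated namespace `Summit.<Summit>.<Problem>` of this single-conjunct summit

noncomputable section

namespace Summit.ResolutionOfSingularities.ResolutionOfSingularities.Cruxes.EquisingularLiftNat.Sections.LargeChar

/-- ★ **The witness `f ∉ 𝔮` and the factorisation of good points through the shrunken base** — see the module docstring. [folklore]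
[OURS · L1 W4.5b · RUNG LC (B5)/(B6) bookkeeping; EL♮(3) NOT proved] -/
theorem exists_witness_factor_through_away_away {R : Type} [CommRing R] (𝔮 : Ideal R) [𝔮.IsPrime]
    (a : R ⧸ 𝔮) (ha : a ≠ 0) (a₀ : Localization.Away a) (ha₀ : a₀ ≠ 0) :
    ∃ f : R, f ∉ 𝔮 ∧ ∀ (k : Type) [Field k] (θ : R →+* k), 𝔮 ≤ RingHom.ker θ → θ f ≠ 0 →
      ∃ θB : Localization.Away a₀ →+* k,
        θB.comp ((algebraMap (Localization.Away a) (Localization.Away a₀)).comp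
          ((algebraMap (R ⧸ 𝔮) (Localization.Away a)).comp (Ideal.Quotient.mk 𝔮))) = θ := by
  classical
  -- write `a₀ · a^m = a₁` with `a₁ : A`
  obtain ⟨⟨a₁, ⟨am, ⟨m, rfl⟩⟩⟩, h₀⟩ := IsLocalization.surj (Submonoid.powers a) a₀
  simp only at h₀
  -- lifts to `R`
  obtain ⟨r, hr⟩ := Ideal.Quotient.mk_surjective a
  obtain ⟨r₁, hr₁⟩ := Ideal.Quotient.mk_surjective a₁
  have ha₁ : a₁ ≠ 0 := by
    intro h1
    rw [h1, map_zero] at h₀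
    have hu : IsUnit (algebraMap (R ⧸ 𝔮) (Localization.Away a) (a ^ m)) := by
      rw [map_pow]; exact (IsLocalization.Away.algebraMap_isUnit a).pow m
    exact ha₀ ((hu.mul_left_eq_zero).mp h₀)
  refine ⟨r * r₁, ?_, fun k _ θ hker hθf => ?_⟩
  · intro hmem
    have h := (Ideal.Quotient.eq_zero_iff_mem).mpr hmem
    rw [map_mul, hr, hr₁] at h
    rcases mul_eq_zero.mp h with h | h
    · exact ha h
    · exact ha₁ h
  -- factor through `A = R ⧸ 𝔮`
  set θA : R ⧸ 𝔮 →+* k := Ideal.Quotient.lift 𝔮 θ (fun x hx => hker hx) with hθA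
  have hθA_mk : θA.comp (Ideal.Quotient.mk 𝔮) = θ := RingHom.ext fun x => Ideal.Quotient.lift_mk 𝔮 θ (fun x hx => hker hx)
  have hθa : θA a ≠ 0 ∧ θA a₁ ≠ 0 := by
    have h : θ (r * r₁) = θA a * θA a₁ := by
      rw [← hθA_mk, RingHom.comp_apply, map_mul, hr, hr₁, map_mul]
    rw [h] at hθf
    exact ⟨left_ne_zero_of_mul hθf, right_ne_zero_of_mul hθf⟩
  -- through `A[1/a]`
  set θA' : Localization.Away a →+* k := IsLocalization.Away.lift a (Ne.isUnit hθa.1) with hθA'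
  have hθA'_comp : θA'.comp (algebraMap (R ⧸ 𝔮) (Localization.Away a)) = θA := IsLocalization.Away.lift_comp a _
  have hθa₀ : θA' a₀ ≠ 0 := by
    intro h0
    have h := congrArg θA' h₀
    rw [map_mul, h0, zero_mul, IsLocalization.Away.lift_eq] at h
    exact hθa.2 h.symm
  -- through `B = A[1/a][1/a₀]`
  refine ⟨IsLocalization.Away.lift a₀ (Ne.isUnit hθa₀), ?_⟩
  rw [← RingHom.comp_assoc, IsLocalization.Away.lift_comp, ← RingHom.comp_assoc, hθA'_comp, hθA_mk]

end Summit.ResolutionOfSingularities.ResolutionOfSingularities.Cruxes.EquisingularLiftNat.Sections.LargeChar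

end
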